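import Summits.RiemannHypothesis.RiemannHypothesis.Theorems.HandoffDodgerPotential
import Summits.RiemannHypothesis.RiemannHypothesis.Theorems.HandoffDodgerDenominators
import HarnessLib

/-!
# HANDOFF — the POINTWISE COST BOUND of the dodger at an unkilled zero, on or off the line, near or far (rh-explicit, track «HANDOFF», seat prove-2 gen9, ATTEMPT-18 (D-4) assembled)

HONEST FRAMING. Nothing here bears on the truth of RH; this is zero COUNTING plus elementary inequalities. The dodger of ATTEMPT-16, in
the kernel form of ATTEMPT-18 (D-2)/(D-3), kills the multiset `zerosBetween 0 T` (`K := N(T)`, killing height `T ≥ ℓ_K = πK/b`) against the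
lattice `ℓ_k = πk/b` (`1 ≤ k ≤ K`); its transform at `s = ½ + iz` is, up to the constant `c_∞`,
`(sin bz/(bz)) · Π_ρ(z² − z_ρ²)^{m(ρ)} / Π_{k≤K}(z² − ℓ_k²)` with `z_ρ = −i(ρ − ½) = Im ρ + i(½ − Re ρ)`. THIS FILE bounds its squared
modulus at ANY point `z = γ + iη` with `|η| ≤ ½`, `γ > T`, `γ ≥ 1` — i.e. at every unkilled zero, on or off the critical line — by assembling
`HandoffDodgerPotential` (killed zeros vs lattice by partial summation) and `HandoffDodgerDenominators` (sinc paired with `ℓ_K`, lower lattice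
factors, harmonic lattice sum):

  `‖sin bz‖²/(b²‖z‖²) · (Π_ρ ‖z² − z_ρ²‖^{m(ρ)})² / (Π_{k≤K} ‖z² − ℓ_k²‖)²`
    `≤ 4cosh²(b/2)(1+b)²/(b²γ²) · exp(4·Σ_{k<K} 1/(γ − ℓ_k)) · exp(−(4/(γ+1)²)·∫_0^T t·D(t)dt)`   (`pointwise_cost_le`)

whenever `N − Λ_K ≤ −D` on `[0, T]` (`D ≥ 0` continuous; supplied by `HandoffDodgerHorizonGlue` from the clean horizon). The harmonic sum is
`≤ (b/π)(1 + log(K−1))` for near zeros and `≤ (K−1)/(γ − ℓ_{K−1})` for far ones (`HandoffDodgerDenominators`), and `∫tD ≳ T³/(18π)`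
(`HandoffDodgerDeficitIntegral`). No pairing of zeros with lattice points, no enumeration of the zeros, no near/far case split.
No `sorry`, standard axioms, no definitions.

References: this track (ATTEMPT-16 §4; ATTEMPT-18 §1 (D-4)).
-/

set_option linter.dupNamespace false

noncomputable section

open Real Finset Complex MeasureTheory

namespace Summit.RiemannHypothesis.RiemannHypothesis.Theorems.Handoff

open Literature.NumberTheory.LFunctions Literature.NumberTheory.LFunctions.SchoenfeldBound

/-- **The numerator at an unkilled height**: `Π_ρ ‖z² − z_ρ²‖^{m(ρ)} ≤ Π_ρ ((γ+1)² − (Im ρ)²)^{m(ρ)}` over `zerosBetween 0 T`, for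
`z = γ + iη`, `|η| ≤ ½`, `γ ≥ T` (`z_ρ = Im ρ + i(½ − Re ρ)`, `|½ − Re ρ| ≤ ½`). [this track, ATTEMPT-18 (D-4)] -/
theorem prod_norm_killed_le {T γ η : ℝ} (hη : |η| ≤ 1 / 2) (hγ : T ≤ γ) :
    ∏ ρ ∈ zerosBetween 0 T, ‖((γ : ℂ) + η * I) ^ 2 - (((ρ.im : ℝ) : ℂ) + ((1 / 2 - ρ.re : ℝ) : ℂ) * I) ^ 2‖ ^ riemannZetaZeroOrder ρ ≤
      ∏ ρ ∈ zerosBetween 0 T, ((γ + 1) ^ 2 - ρ.im ^ 2) ^ riemannZetaZeroOrder ρ := by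
  refine Finset.prod_le_prod (fun ρ hρ => ?_) fun ρ hρ => ?_
  · exact zpow_nonneg (norm_nonneg _) _
  · obtain ⟨-, h1, h2, h3, h4⟩ := (mem_zerosBetween le_rfl).1 hρ
    have hm : (0 : ℤ) ≤ riemannZetaZeroOrder ρ := by
      have := zeroOrder_nonneg_of_mem_zerosBetween le_rfl hρ
      exact_mod_cast this
    refine zpow_le_zpow_left₀ hm (norm_nonneg _) ?_
    exact norm_sq_sub_sq_le hη (abs_le.2 ⟨by linarith, by linarith⟩) h3.le (h4.trans hγ)

/-- **ATTEMPT-18 (D-4): THE POINTWISE COST BOUND (kernel).** `b > 0`; killing height `T ≥ 0` with `K := N(T) ≥ 1` and `ℓ_K = πK/b ≤ T`;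
`D ≥ 0` continuous with `N(t) − min(⌊bt/π⌋, K) ≤ −D(t)` on `[0, T]`; a point `z = γ + iη` with `|η| ≤ ½`, `γ > T`, `γ ≥ 1`. Then
`‖sin bz‖²/(b²‖z‖²)·(Π_ρ‖z²−z_ρ²‖^{m})²/(Π_{k<K}‖z²−ℓ_{k+1}²‖)² ≤ 4cosh²(b/2)(1+b)²/(b²γ²)·exp(4Σ_{k<K−1}1/(γ−ℓ_{k+1}))·exp(−(4/(γ+1)²)∫_0^T tD)`.
[this track, ATTEMPT-18 (D-4)] -/
theorem pointwise_cost_le {b T : ℝ} (hb : 0 < b) (hT : 0 ≤ T) (hK1 : 1 ≤ zetaZeroCount T)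
    (hK : π * (zetaZeroCount T) / b ≤ T) {D : ℝ → ℝ} (hD : ContinuousOn D (Set.Icc 0 T))
    (hD0 : ∀ t ∈ Set.Icc 0 T, 0 ≤ D t)
    (hΔ : ∀ t ∈ Set.Icc 0 T, (zetaZeroCount t : ℝ) - ((min ⌊b * t / π⌋₊ (zetaZeroCount T) : ℕ) : ℝ) ≤ -D t)
    {γ η : ℝ} (hη : |η| ≤ 1 / 2) (hγT : T < γ) (hγ1 : 1 ≤ γ) :
    ‖Complex.sin (b * ((γ : ℂ) + η * I))‖ ^ 2 / (b ^ 2 * ‖(γ : ℂ) + η * I‖ ^ 2) *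
        ((∏ ρ ∈ zerosBetween 0 T, ‖((γ : ℂ) + η * I) ^ 2 - (((ρ.im : ℝ) : ℂ) + ((1 / 2 - ρ.re : ℝ) : ℂ) * I) ^ 2‖ ^
            riemannZetaZeroOrder ρ) ^ 2 /
          (∏ k ∈ Finset.range (zetaZeroCount T), ‖((γ : ℂ) + η * I) ^ 2 - ((π * ((k + 1 : ℕ) : ℝ) / b : ℝ) : ℂ) ^ 2‖) ^ 2) ≤
      4 * Real.cosh (b / 2) ^ 2 * (1 + b) ^ 2 / (b ^ 2 * γ ^ 2) *
        Real.exp (4 * ∑ k ∈ Finset.range (zetaZeroCount T - 1), 1 / (γ - π * ((k + 1 : ℕ) : ℝ) / b)) *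
        Real.exp (-(4 / (γ + 1) ^ 2 * ∫ t in (0 : ℝ)..T, t * D t)) := by
  set K : ℕ := zetaZeroCount T with hKdef
  set z : ℂ := (γ : ℂ) + η * I with hz
  have hπ := Real.pi_pos
  have hγ0 : 0 < γ := by linarith
  -- lattice points: positions and positivity
  have hℓpos : ∀ k : ℕ, 0 < π * ((k + 1 : ℕ) : ℝ) / b := fun k => by positivity
  have hℓlt : ∀ k ∈ Finset.range K, π * ((k + 1 : ℕ) : ℝ) / b < γ := by
    intro k hk
    refine lt_of_le_of_lt (le_trans ?_ hK) hγT
    have : ((k + 1 : ℕ) : ℝ) ≤ K := by exact_mod_cast Finset.mem_range.1 hk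
    exact div_le_div_of_nonneg_right (mul_le_mul_of_nonneg_left this hπ.le) hb.le
  -- (1) numerator: killed zeros ≤ potential ≤ lattice⁺ · exp(−c)
  have hN := prod_norm_killed_le (T := T) hη hγT.le
  have hP := prod_killed_le_prod_lattice_mul_exp (γ := γ) hb hT (by linarith) hK hD hD0 hΔ
  set Nz : ℝ := ∏ ρ ∈ zerosBetween 0 T, ‖z ^ 2 - (((ρ.im : ℝ) : ℂ) + ((1 / 2 - ρ.re : ℝ) : ℂ) * I) ^ 2‖ ^
      riemannZetaZeroOrder ρ with hNz
  set Lp : ℝ := ∏ k ∈ Finset.range K, ((γ + 1) ^ 2 - (π * ((k + 1 : ℕ) : ℝ) / b) ^ 2) with hLp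
  set c : ℝ := 2 / (γ + 1) ^ 2 * ∫ t in (0 : ℝ)..T, t * D t with hc
  have hNz0 : 0 ≤ Nz := Finset.prod_nonneg fun ρ _ => zpow_nonneg (norm_nonneg _) _
  have hNzle : Nz ≤ Lp * Real.exp (-c) := hN.trans hP
  -- (2) denominators: split off the top lattice point `ℓ_K` (k = K − 1)
  set Dn : ℝ := ∏ k ∈ Finset.range K, ‖z ^ 2 - ((π * ((k + 1 : ℕ) : ℝ) / b : ℝ) : ℂ) ^ 2‖ with hDn
  have hKsucc : K = (K - 1) + 1 := by omega
  have hℓK : π * (((K - 1) + 1 : ℕ) : ℝ) / b = π * (K : ℝ) / b := by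
    congr 2; exact_mod_cast hKsucc.symm
  have hDn_split : Dn = (∏ k ∈ Finset.range (K - 1), ‖z ^ 2 - ((π * ((k + 1 : ℕ) : ℝ) / b : ℝ) : ℂ) ^ 2‖) *
      ‖z ^ 2 - ((π * (K : ℝ) / b : ℝ) : ℂ) ^ 2‖ := by
    rw [hDn]; conv_lhs => rw [hKsucc]
    rw [Finset.prod_range_succ, hℓK]
  have hLp_split : Lp = (∏ k ∈ Finset.range (K - 1), ((γ + 1) ^ 2 - (π * ((k + 1 : ℕ) : ℝ) / b) ^ 2)) *
      ((γ + 1) ^ 2 - (π * (K : ℝ) / b) ^ 2) := by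
    rw [hLp]; conv_lhs => rw [hKsucc]
    rw [Finset.prod_range_succ, hℓK]
  -- positivity of the denominators
  have hℓKlt : π * (K : ℝ) / b < γ := lt_of_le_of_lt hK hγT
  have hℓK0 : 0 ≤ π * (K : ℝ) / b := by positivity
  have hDlow_pos : 0 < ∏ k ∈ Finset.range (K - 1), ‖z ^ 2 - ((π * ((k + 1 : ℕ) : ℝ) / b : ℝ) : ℂ) ^ 2‖ := by
    refine Finset.prod_pos fun k hk => ?_
    have hk' : k ∈ Finset.range K := Finset.mem_range.2 (by have := Finset.mem_range.1 hk; omega)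
    have h1 := sub_mul_add_le_norm_sq_sub_sq (η := η) (hℓpos k).le (hℓlt k hk').le
    have h2 : 0 < (γ - π * ((k + 1 : ℕ) : ℝ) / b) * (γ + π * ((k + 1 : ℕ) : ℝ) / b) := by
      have := hℓlt k hk'; have := hℓpos k
      exact mul_pos (by linarith) (by linarith)
    exact h2.trans_le (by rw [hz] at *; exact h1)
  have htop_pos : 0 < ‖z ^ 2 - ((π * (K : ℝ) / b : ℝ) : ℂ) ^ 2‖ := by
    have h1 := sub_mul_add_le_norm_sq_sub_sq (η := η) hℓK0 hℓKlt.le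
    have h2 : 0 < (γ - π * (K : ℝ) / b) * (γ + π * (K : ℝ) / b) := mul_pos (by linarith) (by linarith)
    exact h2.trans_le (by rw [hz]; exact h1)
  have hDn_pos : 0 < Dn := by rw [hDn_split]; exact mul_pos hDlow_pos htop_pos
  have hzpos : 0 < ‖z‖ := by
    have := Complex.abs_re_le_norm z
    have hre : z.re = γ := by simp [hz]
    rw [hre, abs_of_pos hγ0] at this
    linarith
  -- (3) the top factor with the sinc, and the lower factors
  have htop := top_factor_div_le (K := K) hb hη (by field_simp : b * (π * (K : ℝ) / b) = π * K) hℓK0 hℓKlt hγ1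
  have hlow := prod_lower_factors_le (Finset.range (K - 1)) (ℓ := fun k => π * ((k + 1 : ℕ) : ℝ) / b) (γ := γ) (η := η)
    (fun k _ => (hℓpos k).le) fun k hk => hℓlt k (Finset.mem_range.2 (by have := Finset.mem_range.1 hk; omega))
  -- `‖z² − ℓ_K²‖ = ‖z − ℓ_K‖·‖z + ℓ_K‖`
  have hfac : ‖z ^ 2 - ((π * (K : ℝ) / b : ℝ) : ℂ) ^ 2‖ = ‖z - ((π * (K : ℝ) / b : ℝ) : ℂ)‖ * ‖z + ((π * (K : ℝ) / b : ℝ) : ℂ)‖ := by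
    rw [← norm_mul]; congr 1; ring
  -- (4) assemble
  have hS : ‖Complex.sin (b * z)‖ ^ 2 / (b ^ 2 * ‖z‖ ^ 2) * (Nz ^ 2 / Dn ^ 2) ≤
      ‖Complex.sin (b * z)‖ ^ 2 / (b ^ 2 * ‖z‖ ^ 2) * ((Lp * Real.exp (-c)) ^ 2 / Dn ^ 2) := by
    exact mul_le_mul_of_nonneg_left (div_le_div_of_nonneg_right (pow_le_pow_left₀ hNz0 hNzle 2) (sq_nonneg Dn))
      (div_nonneg (sq_nonneg _) (mul_nonneg (sq_nonneg b) (sq_nonneg ‖z‖)))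
  refine hS.trans ?_
  -- rewrite the right side as (top factor) · (lower product)² · exp(−2c)
  set Plow : ℝ := ∏ k ∈ Finset.range (K - 1), ((γ + 1) ^ 2 - (π * ((k + 1 : ℕ) : ℝ) / b) ^ 2) /
      ‖z ^ 2 - ((π * ((k + 1 : ℕ) : ℝ) / b : ℝ) : ℂ) ^ 2‖ with hPlow
  have hPlow_eq : Plow = (∏ k ∈ Finset.range (K - 1), ((γ + 1) ^ 2 - (π * ((k + 1 : ℕ) : ℝ) / b) ^ 2)) /
      ∏ k ∈ Finset.range (K - 1), ‖z ^ 2 - ((π * ((k + 1 : ℕ) : ℝ) / b : ℝ) : ℂ) ^ 2‖ := by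
    rw [hPlow, Finset.prod_div_distrib]
  have e : ‖Complex.sin (b * z)‖ ^ 2 / (b ^ 2 * ‖z‖ ^ 2) * ((Lp * Real.exp (-c)) ^ 2 / Dn ^ 2) =
      (‖Complex.sin (b * z)‖ ^ 2 * ((γ + 1) ^ 2 - (π * (K : ℝ) / b) ^ 2) ^ 2 /
          (b ^ 2 * ‖z‖ ^ 2 * (‖z - ((π * (K : ℝ) / b : ℝ) : ℂ)‖ ^ 2 * ‖z + ((π * (K : ℝ) / b : ℝ) : ℂ)‖ ^ 2))) *
        Plow ^ 2 * Real.exp (-c) ^ 2 := by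
    rw [hPlow_eq, hDn_split, hLp_split, hfac]
    field_simp
  rw [e]
  have hexp : Real.exp (-c) ^ 2 = Real.exp (-(4 / (γ + 1) ^ 2 * ∫ t in (0 : ℝ)..T, t * D t)) := by
    rw [← Real.exp_nat_mul, hc]; congr 1; push_cast; ring
  rw [hexp]
  have hPlow0 : 0 ≤ Plow := by
    rw [hPlow]
    refine Finset.prod_nonneg fun k hk => div_nonneg ?_ (norm_nonneg _)
    have hk' : k ∈ Finset.range K := Finset.mem_range.2 (by have := Finset.mem_range.1 hk; omega)
    have h1 := hℓlt k hk'; have h2 := hℓpos k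
    nlinarith only [h1, h2]
  have hPlow2 : Plow ^ 2 ≤ Real.exp (4 * ∑ k ∈ Finset.range (K - 1), 1 / (γ - π * ((k + 1 : ℕ) : ℝ) / b)) := by
    have h1 := pow_le_pow_left₀ hPlow0 hlow 2
    refine h1.trans (le_of_eq ?_)
    rw [← Real.exp_nat_mul]; congr 1; push_cast; ring
  have htop' : ‖Complex.sin (b * z)‖ ^ 2 * ((γ + 1) ^ 2 - (π * (K : ℝ) / b) ^ 2) ^ 2 /
      (b ^ 2 * ‖z‖ ^ 2 * (‖z - ((π * (K : ℝ) / b : ℝ) : ℂ)‖ ^ 2 * ‖z + ((π * (K : ℝ) / b : ℝ) : ℂ)‖ ^ 2)) ≤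
      4 * Real.cosh (b / 2) ^ 2 * (1 + b) ^ 2 / (b ^ 2 * γ ^ 2) := by
    simpa [hz] using htop
  have hB0 : 0 ≤ 4 * Real.cosh (b / 2) ^ 2 * (1 + b) ^ 2 / (b ^ 2 * γ ^ 2) :=
    div_nonneg (mul_nonneg (mul_nonneg (by norm_num) (sq_nonneg _)) (sq_nonneg _)) (mul_nonneg (sq_nonneg _) (sq_nonneg _))
  have hE0 : 0 ≤ Real.exp (-(4 / (γ + 1) ^ 2 * ∫ t in (0 : ℝ)..T, t * D t)) := (Real.exp_pos _).le
  exact mul_le_mul_of_nonneg_right (mul_le_mul htop' hPlow2 (sq_nonneg _) hB0) hE0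

end Summit.RiemannHypothesis.RiemannHypothesis.Theorems.Handoff

end
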